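import Literature.AlgebraicGeometry.HodgeTheory.WeilClassesFieldDecomposableOfSymmetric
import Literature.AlgebraicGeometry.HodgeTheory.WeilClassesFieldIntersections
import Literature.AlgebraicGeometry.HodgeTheory.AbelianLowDimensionWeilReductionProofs
import Literature.AlgebraicGeometry.HodgeTheory.LefschetzOneOneHolds
import Literature.AlgebraicGeometry.HodgeTheory.DivisorLefschetzGroupLargest
import HarnessLib

/-!
# The DIVISOR-FORM CRITERION for Weil classes: ONE divisor form `φ_s(v₁, v₂) = φ(s · v₁, v₂)`, `s ∈ S_λ`, non-degenerate
# on ONE eigenspace `V_ρ` of `F = ℚ(φ) ⊆ B` makes `W_F` decomposable — hence algebraic; and decomposability is decided at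
# a single complex embedding of `F` (Moonen–Zarhin 1998 §1, the mechanism of Criterion (2), classification-free)

Layer `Literature/AlgebraicGeometry/HodgeTheory`; THEOREMS ONLY — no definition, no named fact, sorry-free (D-0026,
net debt 0). Sequel and common generalisation of the seat's `WeilClassesFieldDecomposableOfSymmetric` (g17-#3: `φ^*`
Rosati-symmetric ⟹ `G_div(X) ⊆ Sl_F(V_X)` pointwise, by the determinant of a symplectic isometry of `Q_h|V^{(τ)}`) and
`WeilClassesFieldDecomposableOfSkew` (g17-#5: `φ^*` Rosati-skew with a symmetric anticommuting unit `ψ^*`, by the form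
`Q_h(x, ψ^* y)` on `V^{(τ)}`): both are the cases `s = 1`, `s = ψ^*` of ONE statement about the print's divisor forms
`φ_s`, proved here for an ARBITRARY `†`-symmetric `s` and an ARBITRARY `F ⊆ B`, together with the sharpening «one root
suffices» of the seat's g14-#3 `WeilClassesFieldDecomposableIffDivisorLefschetzGroup`.

## The print

B. J. J. Moonen, Yu. G. Zarhin, *Weil classes on abelian varieties*, J. reine angew. Math. **496** (1998) =
arXiv:alg-geom/9612017 [MoonenZarhin1998WeilClasses] (held text `paper:arxiv-alg-geom_9612017`), §1, chunk p0002
L64–L76, VERBATIM: «We define the algebraic group `G_div(X) ⊆ SP(V, φ)` as the centralizer of `B` in `SP(V, φ)`. More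
precisely, `G_div(X) := Gl_B(V) ∩ SP(V, φ)`. Of course, the main motivation for introducing this group `G_div(X)` is the
fact that it is the largest algebraic subgroup of `Gl(V)` defined over `ℚ` which leaves invariant all divisor classes
in `H²(X, ℚ) = ⋀²V`. In fact, the divisor classes, viewed as alternating bilinear forms on `V`, are precisely the forms
`φ_s : (v₁, v₂) ↦ φ(s · v₁, v₂)` for `s ∈ S_λ`.»; the description of `G_div(X) ⊗ ℂ = ∏_τ G_div^{(τ)}` through
`SP(V_Y, φ_Y) ⊗ ℂ = ∏_τ SP(V^{(τ)}, φ^{(τ)})` (chunk p0002 L86–L100, Table 2); and the proof of Criterion (2) (chunk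
p0003 L62–L70): «We claim that, in these cases, `G_div(X)` acts as the identity on `W_F` if and only if `F ⊆ B`. […]
Conversely, suppose that `F ⊆ B`, so that `G_div(X) ⊆ Gl_F(V_X)`. In the cases we are considering, the group `G_div(X)`
is connected and semi-simple, so `G_div(X) ⊆ Sl_F(V_X)`, hence `G_div(X)` acts trivially on `W_F`.»

## The carrier (as in g13-#6 / g14-#3 / g17-#3: `ℂ`-points, read on `H¹(A(ℂ); ℂ)`)

`V ⊗ ℂ = H¹(A(ℂ); ℂ) = complexBetti A.X 1`; `φ ⊗ ℂ ∝ Q_h(x, y) = h^{dim A - 1} ∪ x ∪ y` (`Motives.polarizationPairingOne`,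
values in the top line `H^{2 dim A}`) for `h ∈ B¹(A) ⊗ ℂ` with `Q_h` non-degenerate (every polarization class);
`S_λ ⊗ ℂ = symmetricPullbackSpan A h` (the `Q_h`-self-adjoint combinations of pull-backs), `B ⊗ ℂ = Algebra.adjoin ℂ (S_λ ⊗ ℂ)`,
`G_div(X)(ℂ) = divisorLefschetzGroup A h`; THE DIVISOR FORM of `s ∈ S_λ ⊗ ℂ` is `φ_s(x, y) = Q_h(s x, y)` — alternating, and,
by the seat's g14-#1 `DivisorLefschetzGroupLargest` (`mem_symmetricPullbackSpan_iff_exists_contractionOp_eq`), these are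
EXACTLY the forms `B(T_c x, y)` of the divisor classes `c ∈ B¹(A) ⊗ ℂ` (`T_c = Milne1999.contractionOp`, `B = λ ∘ Q_h`);
`F = ℚ(φ)`, `P(φ) = 0` with `P ∈ ℤ[T]` monic irreducible of degree `e`, `e · 2m = 2 dim A`; `V_ρ = ker(φ^* - ρ)`
(`Module.End.eigenspace (pullbackOne A φ) ρ`) for a complex root `ρ` of `P`; `W_F ⊗ ℂ = weilClassesField A φ P (2m) = ⊕_ρ ⋀^{2m} V_ρ`;
`𝒟ᵐ ⊗ ℂ = divisorClassesSpan A.X (dim A) m`; `det(u | V_ρ) = VanGeemen1994.detOnEigenspace`.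

## What is proved

* §1 **`LinearAlgebra.det_restrict_eq_one_of_isAlt_of_forall_apply_apply_eq`** (any field) — an endomorphism `u`
  preserving a bilinear form `Φ` has determinant `1` on every `u`-invariant subspace `W` on which `Φ` is alternating and
  non-degenerate (the tree's `det_eq_one_of_isAlt_of_forall_apply_apply_eq`, McDuff–Salamon Lemma 1.1.15, on `Φ|W`).
* §2 **`detOnEigenspace_eq_one_of_divisorForm`** — THE MECHANISM, for EVERY complex abelian variety (no hypothesis on
  `dim A`, `P`, or `h`): if `s` is `Q_h`-symmetric, `u` is a `Q_h`-isometry commuting with `s` and with `φ^*`, and the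
  divisor form `φ_s|V_τ` is non-degenerate, then `det(u | V_τ) = 1` (`φ_s` is alternating because `s` is symmetric and
  `Q_h` is skew; `u|V_τ` is an isometry of `φ_s|V_τ`). For `u ∈ G_div(X)(ℂ)` and `s ∈ S_λ ⊗ ℂ`:
  **`detOnEigenspace_eq_one_of_mem_divisorLefschetzGroup_of_divisorForm`** (and `…_of_mem_adjoin` for `φ^* ∈ B ⊗ ℂ`,
  `…_of_mem_unitaryCentralizerGroup_…` for Milne's `S(A)(h)(ℂ) ≤ G_div(X)(ℂ)`) — the factor «`G_div^{(τ)} ⊆ Sp ⊆ SL`» of the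
  print's decomposable cases, read off ONE symmetric endomorphism instead of Table 2.
* §3 **ONE ROOT SUFFICES** (`m ≠ 0`, `h ∈ B¹(A) ⊗ ℂ` with `Q_h` non-degenerate):
  **`weilClassesField_le_divisorClassesSpan_of_forall_detOnEigenspace_eq_one_at`** — if at ONE complex root `ρ` every
  `u ∈ G_div(X)(ℂ)` commutes with `φ^*` and has `det(u | V_ρ) = 1`, then `W_F ⊗ ℂ ≤ 𝒟ᵐ ⊗ ℂ` (the generator of the Weil line
  `⋀^{2m} V_ρ` is then `G_div(X)(ℂ)`-fixed, hence decomposable by Lemma (3), third clause — the seat's g14-#3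
  `mem_divisorClassesSpan_iff_forall_mem_divisorLefschetzGroup`, resting on Milne 1999 Thm. 3.2 / Cor. 4.5 — and «all or
  nothing» propagates to the other lines); the equivalences **`…_iff_forall_detOnEigenspace_eq_one_at`**,
  **`…_iff_forall_detOnEigenspace_eq_one_at_of_mem_adjoin`** (for `F ⊆ B`), and the exceptional alternative
  **`weilClassesField_inf_divisorClassesSpan_eq_bot_iff_exists_mem_divisorLefschetzGroup_at`**: `W_F` is exceptional iff at
  EVERY (equivalently some) root some `u ∈ G_div(X)(ℂ)` lies outside `Sl(V_ρ)` — sharpening g14-#3 («at some root»).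
* §4 **THE DIVISOR-FORM CRITERION**: **`weilClassesField_le_divisorClassesSpan_of_divisorForm`** — `φ^* ∈ B ⊗ ℂ`, and
  ONE `s ∈ S_λ ⊗ ℂ` whose divisor form `φ_s` is non-degenerate on ONE `V_ρ` ⟹ `W_F ⊗ ℂ ≤ 𝒟ᵐ ⊗ ℂ`: THE WEIL CLASSES RELATIVE
  TO `F` ARE DECOMPOSABLE; hence Hodge (`…_le_hodgeClassSpan_of_divisorForm`) and ALGEBRAIC
  (**`weilClassesField_le_algebraicClasses_of_divisorForm`**, the Lefschetz theorem on `(1,1)`-classes of the tree); and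
  then `det(u | V_{ρ′}) = 1` at EVERY root (`detOnEigenspace_eq_one_of_divisorForm_of_root`). Instances:
  **`weilClassesField_le_divisorClassesSpan_of_nondegenerate_restrict`** (`s = 1`: `F ⊆ B` and `Q_h|V_ρ` non-degenerate
  at one root — g17-#3 had `F ⊆ S_λ` pointwise) and `…_of_symm_pullback` (`s = ψ^*` a symmetric pull-back — g17-#5's `ψ`
  without skewness of `φ` or anticommutation, granted `φ^* ∈ B ⊗ ℂ`).
* §5 **`weilClassesField_le_divisorClassesSpan_of_contractionOp`** — the same with the print's words made literal: a
  DIVISOR CLASS `c ∈ B¹(A) ⊗ ℂ` whose alternating form `B(T_c x, y)` («divisor classes, viewed as alternating bilinear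
  forms on `V`») is non-degenerate on one `V_ρ` (`dim A ≥ 1`).
* §6 (rider) THE PROJECTION CRITERION: **`weilClassesField_le_divisorClassesSpan_of_symm_idempotent`** /
  **`weilClassesField_le_algebraicClasses_of_symm_idempotent`** — `φ^* ∈ B ⊗ ℂ` and a symmetric IDEMPOTENT `s ∈ S_λ ⊗ ℂ`
  (`pullbackOne_mul_self_of_comp_eq`: the pull-back of a Rosati-symmetric idempotent endomorphism, a «factor») mapping
  ONE `V_ρ` injectively onto `s(H¹)` ⟹ `φ_s|V_ρ` non-degenerate
  (`forall_polarizationPairingOne_apply_eq_zero_imp_of_symm_idempotent`) ⟹ `W_F` decomposable and algebraic — the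
  mechanism of the `F`-split abelian varieties `A ⊗ F` (`A^n`, `F ⊆ M_n(ℚ)`; Deligne's `A₀ ⊗ E`).

Scope (said once, precisely): carrier statements for EVERY complex abelian variety and every `h ∈ B¹(A) ⊗ ℂ` with `Q_h`
non-degenerate; the criterion is SUFFICIENT. Consistency with the print (my reading of Table 2, NOT formalised and not
used): in each decomposable case of Criterion (2) such an `s` exists — `s = 1` on a factor `Sp(V^{(τ)})` (types 1–3 with
`F ⊆ E`-isotypic eigenspaces, type 4 with `d = m = 1`, `F ⊆ E₀`), a symmetric element pairing `V_ρ` with its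
`Q_h`-partner in type 2, one of even rank in type 3 with `2m/[F:E]` even, and one pairing `V_ρ ∩ V^{(σ)}` with
`V_ρ ∩ V^{(σ̄)}` in type 4 with `θ = 0` — while in the exceptional cases none exists. NOT here: that converse
(«decomposable ⟹ some `φ_s|V_ρ` non-degenerate», which needs the Albert classification / Table 2), `G_div(X)` as an
algebraic `ℚ`-group, connectedness, Tate classes (§3 of the print).

## References

* [MoonenZarhin1998WeilClasses] B. J. J. Moonen, Yu. G. Zarhin, J. reine angew. Math. 496 (1998) =
  arXiv:alg-geom/9612017, §1: `S_λ`, `B`, `G_div(X)`, «the divisor classes … are precisely the forms `φ_s`» (chunk p0002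
  L53–L76), `G_div ⊗ ℂ = ∏_τ G_div^{(τ)}` and Table 2 (chunk p0002 L86–L100), Lemma (2)–(3) (chunk p0003 L4–L45),
  Criterion (2) and its proof (chunk p0003 L46–L90), «all or nothing» (chunk p0001 L57–L66).
* [Milne1999LefschetzClasses] J. S. Milne, Lefschetz classes on abelian varieties, Duke Math. J. 96 (1999), §1 Prop. 1.3
  and Remark 1.2 (p. 643–644), Thm. 3.2 / Prop. 3.3 (p. 653), Thm. 4.4 / Cor. 4.5 (p. 659).
* [McDuffSalamon2017] D. McDuff, D. Salamon, Introduction to Symplectic Topology, 3rd ed. (OUP 2017), Lemma 1.1.15,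
  Thm. 2.1.3.
* [LangeBirkenhake1992] H. Lange, Ch. Birkenhake, Complex Abelian Varieties (1992), §5.1 (Rosati = adjoint),
  Prop. 5.2.1 (`NS_ℚ(X) ≅ End⁰(X)^{sym}`), Lemma 1.1.17.
* [vanGeemen1994HodgeAV] B. van Geemen, LNM 1594 (1994), 2.4–2.5 (exceptional classes), 6.9–6.10 (`det(B ± √-d C)`).
* [VoisinHodgeI2002] C. Voisin, Hodge Theory and Complex Algebraic Geometry I (CUP 2002), Thm. 11.30 (Lefschetz `(1,1)`).
* [HatcherAT2002] A. Hatcher, Algebraic Topology (CUP 2002), Thm. 3.11 (graded commutativity).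
* [Deligne1982HodgeCycles] P. Deligne, Hodge cycles on abelian varieties, LNM 900 (1982), §4 (4.4)–(4.5) (`A₀ ⊗ E`).

## Provenance

Lane `lit-hodgefound` (Track 2, Layer A), prover seat `lit-hodgefound-p21` (generation 18), row g18-#1: successor note
(a) of generation 17 («type 2 with a generator that is neither †-symmetric nor †-skew … u centralises … ⟹ det 1»)
answered by the common generalisation of g17-#3 / g17-#5 — the determinant-one mechanism needs ONE symmetric `s` with
`φ_s|V_ρ` non-degenerate, nothing about `φ^*` itself beyond `φ^* ∈ B ⊗ ℂ`.
-/

noncomputable section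

open CategoryTheory Polynomial Module

/-! ### §1 Linear algebra: determinant `1` on an invariant subspace carrying an invariant symplectic form -/

namespace Literature.LinearAlgebra

/-- **An endomorphism preserving a bilinear form `Φ` has determinant `1` on every invariant subspace `W` on which `Φ`
is alternating and non-degenerate** (any field): `u|W` is an isometry of the non-degenerate alternating form `Φ|W`, so
`det(u|W) = 1` (the tree's `det_eq_one_of_isAlt_of_forall_apply_apply_eq`: symplectic basis, McDuff–Salamon Thm. 2.1.3,
and «every symplectic matrix has determinant `1`», Lemma 1.1.15). Only the values of `Φ` on `W × W` matter.
[cite: McDuffSalamon2017, Lemma 1.1.15 and Thm. 2.1.3] -/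
theorem det_restrict_eq_one_of_isAlt_of_forall_apply_apply_eq {K V : Type*} [Field K] [AddCommGroup V] [Module K V]
    [FiniteDimensional K V] (Φ : LinearMap.BilinForm K V) {W : Submodule K V} {u : V →ₗ[K] V}
    (hW : Set.MapsTo u W W) (halt : ∀ x ∈ W, Φ x x = 0) (hsep : ∀ x ∈ W, (∀ y ∈ W, Φ x y = 0) → x = 0)
    (hiso : ∀ x ∈ W, ∀ y ∈ W, Φ (u x) (u y) = Φ x y) : LinearMap.det (u.restrict hW) = 1 := by
  set B : LinearMap.BilinForm K W := Φ.compl₁₂ W.subtype W.subtype with hBdef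
  have hBapply : ∀ x y : W, B x y = Φ (x : V) (y : V) := fun _ _ ↦ rfl
  have hBalt : B.IsAlt := fun x ↦ by
    rw [hBapply]
    exact halt x x.2
  have hBsep : B.SeparatingLeft := fun x hx ↦
    Subtype.ext (hsep x x.2 fun y hy ↦ by
      rw [← hBapply x ⟨y, hy⟩]
      exact hx ⟨y, hy⟩)
  have hBnd : B.Nondegenerate :=
    (LinearMap.IsRefl.nondegenerate_iff_separatingLeft (LinearMap.IsAlt.isRefl hBalt)).2 hBsep
  refine det_eq_one_of_isAlt_of_forall_apply_apply_eq B hBalt hBnd _ fun x y ↦ ?_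
  rw [hBapply, hBapply, LinearMap.coe_restrict_apply, LinearMap.coe_restrict_apply]
  exact hiso x x.2 y y.2

end Literature.LinearAlgebra

/-! ### §2 The mechanism on the carrier `H¹(A(ℂ); ℂ)`: a non-degenerate divisor form on `V_τ` forces `det(u | V_τ) = 1` -/

namespace Literature.AlgebraicGeometry.HodgeTheory

open Literature.AlgebraicGeometry.Motives
open Literature.AlgebraicGeometry.VanGeemen1994 (hodgeClassSpan pullbackOne detOnEigenspace)
open Literature.AlgebraicGeometry.Milne1999 (unitaryCentralizerGroup contractionOp exists_injective_linearMap_topDegree)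
open Literature.AlgebraicTopology.SingularHomology
open Literature.Barriers.HodgeConjecture (divisorClassesSpan)

section HodgeTheory

variable {A : AbelianVariety ℂ} {h : complexBetti A.X 2} {φ ψ : A ⟶ A} {P : Polynomial ℤ} {e m : ℕ}
  {u : complexBetti A.X 1 ≃ₗ[ℂ] complexBetti A.X 1} {s : Module.End ℂ (complexBetti A.X 1)}

/-- **THE MECHANISM — `det(u | V_τ) = 1` from ONE non-degenerate divisor form**, for EVERY complex abelian variety `A`,
every `h ∈ H²(A(ℂ); ℂ)`, every endomorphism `φ` and every `τ ∈ ℂ`: let `s` be a `Q_h`-SYMMETRIC endomorphism of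
`H¹(A(ℂ); ℂ)` (`Q_h(s x, y) = Q_h(x, s y)`) and `u` a `Q_h`-isometry commuting with `s` and with `φ^*`; if the DIVISOR FORM
`φ_s(x, y) = Q_h(s x, y)` is non-degenerate on `V_τ = ker(φ^* - τ)`, then `det(u | V_τ) = 1`. Road: `φ_s` is alternating
(`Q_h(s x, x) = Q_h(x, s x) = -Q_h(s x, x)`, graded commutativity), `u` preserves `V_τ` and `φ_s`
(`Q_h(s u x, u y) = Q_h(u s x, u y) = Q_h(s x, y)`), and an isometry of a non-degenerate alternating form has determinant
`1` (§1, after composing `Q_h` with an injective functional on the top line `H^{2 dim A}`,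
`Milne1999.exists_injective_linearMap_topDegree`). This is the factor «`G_div^{(τ)} ⊆ SP(V^{(τ)}, φ^{(τ)})`» of the print's
«`SP(V_Y, φ_Y) ⊗ ℂ = ∏_τ SP(V^{(τ)}, φ^{(τ)})`» with `φ^{(τ)}` replaced by ANY of «the forms `φ_s : (v₁, v₂) ↦ φ(s · v₁, v₂)`
for `s ∈ S_λ`» — classification-free and connectedness-free.
[cite: MoonenZarhin1998WeilClasses, §1 («the divisor classes … are precisely the forms φ_s», chunk p0002 L72–L76; G_div ⊗ ℂ = ∏_τ G_div^{(τ)}, chunk p0002 L86–L100; proof of Criterion (2), chunk p0003 L62–L70)]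
[cite: McDuffSalamon2017, Lemma 1.1.15] [cite: HatcherAT2002, Thm. 3.11] -/
theorem detOnEigenspace_eq_one_of_divisorForm
    (hsym : ∀ x y : complexBetti A.X 1, polarizationPairingOne A.X h (A.dim - 1) (s x) y =
      polarizationPairingOne A.X h (A.dim - 1) x (s y))
    (hus : ∀ x, u (s x) = s (u x)) (hc : ∀ x, u (pullbackOne A φ x) = pullbackOne A φ (u x))
    (huQ : ∀ x y : complexBetti A.X 1, polarizationPairingOne A.X h (A.dim - 1) (u x) (u y) =
      polarizationPairingOne A.X h (A.dim - 1) x y) (τ : ℂ)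
    (hsnd : ∀ x ∈ Module.End.eigenspace (pullbackOne A φ) τ,
      (∀ y ∈ Module.End.eigenspace (pullbackOne A φ) τ, polarizationPairingOne A.X h (A.dim - 1) (s x) y = 0) → x = 0) :
    detOnEigenspace u (pullbackOne A φ) hc τ = 1 := by
  classical
  haveI : Module.Finite ℂ (complexBetti A.X 1) := abelianVarietyCohomologyExteriorH1_holds.finite_one A
  obtain ⟨ℓ, hℓ⟩ := exists_injective_linearMap_topDegree A
  -- the scalar divisor form `Φ(x, y) = ℓ(Q_h(s x, y))` on `H¹(A(ℂ); ℂ)`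
  set Φ : LinearMap.BilinForm ℂ (complexBetti A.X 1) :=
    ((polarizationPairingOne A.X h (A.dim - 1)) ∘ₗ s).compr₂ ℓ with hΦdef
  have hΦapply : ∀ x y, Φ x y = ℓ (polarizationPairingOne A.X h (A.dim - 1) (s x) y) := fun _ _ ↦ rfl
  refine Literature.LinearAlgebra.det_restrict_eq_one_of_isAlt_of_forall_apply_apply_eq Φ
    (VanGeemen1994.mapsTo_eigenspace_of_comm hc τ) (fun x _ ↦ ?_) (fun x hx hx0 ↦ hsnd x hx fun y hy ↦ ?_)
    (fun x _ y _ ↦ ?_)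
  · -- alternating: `Q_h(s x, x) = Q_h(x, s x) = -Q_h(s x, x)`
    have e : polarizationPairingOne A.X h (A.dim - 1) (s x) x = -polarizationPairingOne A.X h (A.dim - 1) (s x) x :=
      (hsym x x).trans (polarizationPairingOne_swap h (A.dim - 1) (s x) x)
    rw [eq_neg_iff_add_eq_zero, ← two_smul ℂ] at e
    rw [hΦapply, (smul_eq_zero.1 e).resolve_left two_ne_zero, map_zero]
  · -- non-degeneracy on `V_τ`, through the injective `ℓ`
    exact hℓ (by rw [← hΦapply, hx0 y hy, map_zero])
  · -- `u|V_τ` is an isometry of `Φ`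
    rw [hΦapply, hΦapply, LinearEquiv.coe_coe, ← hus, huQ]

/-- **Every `u ∈ G_div(X)(ℂ)` commuting with `φ^*` has `det(u | V_τ) = 1` as soon as ONE `s ∈ S_λ ⊗ ℂ` has its divisor form
`φ_s = Q_h(s ·, ·)` non-degenerate on `V_τ`** (every complex abelian variety, every `h`, every `τ`): `u` commutes with
`s ∈ S_λ ⊗ ℂ` and preserves `Q_h` by definition of `G_div(X)(ℂ) = Gl_B(V) ∩ Sp(V, φ)`.
[cite: MoonenZarhin1998WeilClasses, §1 (definition of G_div(X) and «the forms φ_s», chunk p0002 L64–L76; proof of Criterion (2), chunk p0003 L62–L70)]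
[cite: McDuffSalamon2017, Lemma 1.1.15] -/
theorem detOnEigenspace_eq_one_of_mem_divisorLefschetzGroup_of_divisorForm (hs : s ∈ symmetricPullbackSpan A h)
    (hu : u ∈ divisorLefschetzGroup A h) (hc : ∀ x, u (pullbackOne A φ x) = pullbackOne A φ (u x)) (τ : ℂ)
    (hsnd : ∀ x ∈ Module.End.eigenspace (pullbackOne A φ) τ,
      (∀ y ∈ Module.End.eigenspace (pullbackOne A φ) τ, polarizationPairingOne A.X h (A.dim - 1) (s x) y = 0) → x = 0) :
    detOnEigenspace u (pullbackOne A φ) hc τ = 1 :=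
  detOnEigenspace_eq_one_of_divisorForm hs.2 (hu.1 s hs) hc hu.2 τ hsnd

/-- The same for `φ^* ∈ B ⊗ ℂ = Algebra.adjoin ℂ (S_λ ⊗ ℂ)` («`F ⊆ B`, so that `G_div(X) ⊆ Gl_F(V_X)`»: the commutation of
`u ∈ G_div(X)(ℂ)` with `φ^*` is then automatic, `divisorLefschetzGroup_comm_of_mem_adjoin`), in the shape consumed by the
seat's g14-#3 `weilClassesField_le_divisorClassesSpan_iff_forall_detOnEigenspace_eq_one_of_mem_adjoin`.
[cite: MoonenZarhin1998WeilClasses, §1 proof of Criterion (2) (chunk p0003 L66–L70)] -/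
theorem detOnEigenspace_eq_one_of_mem_divisorLefschetzGroup_of_divisorForm_of_mem_adjoin
    (hF : pullbackOne A φ ∈ Algebra.adjoin ℂ (symmetricPullbackSpan A h : Set (Module.End ℂ (complexBetti A.X 1))))
    (hs : s ∈ symmetricPullbackSpan A h) (hu : u ∈ divisorLefschetzGroup A h) (τ : ℂ)
    (hsnd : ∀ x ∈ Module.End.eigenspace (pullbackOne A φ) τ,
      (∀ y ∈ Module.End.eigenspace (pullbackOne A φ) τ, polarizationPairingOne A.X h (A.dim - 1) (s x) y = 0) → x = 0) :
    detOnEigenspace u (pullbackOne A φ)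
      (comm_pullbackOne_of_mem_divisorLefschetzGroup_of_pullbackOne_mem_adjoin hF hu) τ = 1 :=
  detOnEigenspace_eq_one_of_mem_divisorLefschetzGroup_of_divisorForm hs hu _ τ hsnd

/-- The same for Milne's smaller group `S(A)(h)(ℂ) ≤ G_div(X)(h)(ℂ)` (`unitaryCentralizerGroup_le_divisorLefschetzGroup`),
which commutes with every pull-back. [cite: MoonenZarhin1998WeilClasses, §1 (chunk p0002 L64–L76)] [cite: Milne1999LefschetzClasses, §1 p. 644] -/
theorem detOnEigenspace_eq_one_of_mem_unitaryCentralizerGroup_of_divisorForm (hs : s ∈ symmetricPullbackSpan A h)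
    (hu : u ∈ unitaryCentralizerGroup A h) (τ : ℂ)
    (hsnd : ∀ x ∈ Module.End.eigenspace (pullbackOne A φ) τ,
      (∀ y ∈ Module.End.eigenspace (pullbackOne A φ) τ, polarizationPairingOne A.X h (A.dim - 1) (s x) y = 0) → x = 0) :
    detOnEigenspace u (pullbackOne A φ) (fun x ↦ (Milne1999.mem_centralizerGroup_iff.1 hu.1) φ x) τ = 1 :=
  detOnEigenspace_eq_one_of_mem_divisorLefschetzGroup_of_divisorForm hs
    (unitaryCentralizerGroup_le_divisorLefschetzGroup hu) _ τ hsnd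

/-! ### §3 One root suffices: decomposability of `W_F` is decided on a single Weil line `⋀^{2m} V_ρ` -/

/-- **ONE ROOT SUFFICES — «`G_div(X)` acts as the identity on `W_F`» may be tested at a single complex embedding of `F`**:
for `P ∈ ℤ[T]` monic irreducible of degree `e`, `P(φ) = 0`, `e · 2m = 2 dim A`, `m ≠ 0`, `h ∈ B¹(A) ⊗ ℂ` with `Q_h`
non-degenerate, and ONE complex root `ρ` of `P`: if every `u ∈ G_div(X)(ℂ)` commutes with `φ^*` and has
`det(u | V_ρ) = 1`, then `W_F ⊗ ℂ ≤ 𝒟ᵐ ⊗ ℂ` — ALL Weil classes relative to `F` are decomposable. Road: the Weil line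
`⋀^{2m} V_ρ ⊆ W_F ⊗ ℂ` has a non-zero generator `ω` (`exists_generator_pullbackEigenclasses_of_root`) on which `⋀^{2m}u`
acts by `det(u | V_ρ)` (`apply_eq_detOnEigenspace_smul_of_comm`), so `ω` is `G_div(X)(ℂ)`-fixed, hence `ω ∈ 𝒟ᵐ ⊗ ℂ` by
Lemma (3), third clause, on the carrier (`mem_divisorClassesSpan_iff_forall_mem_divisorLefschetzGroup`, Milne 1999
Thm. 3.2 / Cor. 4.5); then `W_F ⊗ ℂ ⊓ 𝒟ᵐ ⊗ ℂ ≠ 0` and «all or nothing» (`weilClassesField_inf_divisorClassesSpan_eq_bot_or_le`)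
gives `W_F ⊗ ℂ ≤ 𝒟ᵐ ⊗ ℂ`. [cite: MoonenZarhin1998WeilClasses, §1 «all or nothing» (chunk p0001 L57–L66), Lemma (2)–(3) (chunk p0003 L4–L45), proof of Criterion (2) (chunk p0003 L62–L70)]
[cite: Milne1999LefschetzClasses, Thm. 3.2, Thm. 4.4 and Cor. 4.5 (p. 659)] -/
theorem weilClassesField_le_divisorClassesSpan_of_forall_detOnEigenspace_eq_one_at
    (hPm : P.Monic) (hPe : P.natDegree = e) (hPirr : Irreducible (P.map (Int.castRingHom ℚ)))
    (hφ : Polynomial.eval₂ (Int.castRingHom (CategoryTheory.End A)) (φ : CategoryTheory.End A) P = 0)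
    (her : e * (2 * m) = 2 * A.dim) (hm : m ≠ 0) (hh : h ∈ hodgeClassSpan A.dim A.X 1)
    (hnd : ∀ x : complexBetti A.X 1, (∀ y, polarizationPairingOne A.X h (A.dim - 1) x y = 0) → x = 0)
    {ρ : ℂ} (hρ : Polynomial.eval₂ (Int.castRingHom ℂ) ρ P = 0)
    (hdet : ∀ u ∈ divisorLefschetzGroup A h, ∃ hc : ∀ x, u (pullbackOne A φ x) = pullbackOne A φ (u x),
      detOnEigenspace u (pullbackOne A φ) hc ρ = 1) :
    weilClassesField A φ P (2 * m) ≤ divisorClassesSpan A.X A.dim m := by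
  obtain ⟨ω, hω, hω0, -, -⟩ := exists_generator_pullbackEigenclasses_of_root hPm hPe hPirr hφ her hρ
  -- the generator of the Weil line `⋀^{2m} V_ρ` is fixed by `G_div(X)(ℂ)`, hence decomposable (Lemma (3))
  have hωD : ω ∈ divisorClassesSpan A.X A.dim m := by
    refine (mem_divisorClassesSpan_iff_forall_mem_divisorLefschetzGroup hh hnd m ω).2 fun u hu ↦ ?_
    obtain ⟨hc, hdet1⟩ := hdet u hu
    rw [apply_eq_detOnEigenspace_smul_of_comm hPm hPe hPirr hφ her (exteriorPullback_cupPowOne_abelianVariety u _) hc hρ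
      hω, hdet1, one_smul]
  -- all or nothing
  rcases weilClassesField_inf_divisorClassesSpan_eq_bot_or_le hPe hPirr hφ her hm with hbot | hle
  · have h0 : ω ∈ weilClassesField A φ P (2 * m) ⊓ divisorClassesSpan A.X A.dim m :=
      ⟨pullbackEigenclasses_le_weilClassesField hρ hω, hωD⟩
    rw [hbot, Submodule.mem_bot] at h0
    exact absurd h0 hω0
  · exact hle

/-- **«`W_F` decomposable ⟺ `G_div(X) ⊆ Sl_F(V_X)`», TESTED AT ONE ROOT**: for `P` monic irreducible of degree `e`,
`P(φ) = 0`, `e · 2m = 2 dim A`, `m ≠ 0`, `h ∈ B¹(A) ⊗ ℂ` with `Q_h` non-degenerate, and any complex root `ρ` of `P`: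
`W_F ⊗ ℂ ≤ 𝒟ᵐ ⊗ ℂ` iff every `u ∈ G_div(X)(ℂ)` commutes with `φ^*` and has `det(u | V_ρ) = 1` AT THIS `ρ` («⟹» is the seat's
g14-#3 `weilClassesField_le_divisorClassesSpan_iff_divisorLefschetzGroup_le_slF`, at all roots).
[cite: MoonenZarhin1998WeilClasses, §1 Lemma (2)–(3) and proof of Criterion (2) (chunk p0003 L4–L70)]
[cite: Milne1999LefschetzClasses, Thm. 3.2, Cor. 4.5] -/
theorem weilClassesField_le_divisorClassesSpan_iff_forall_detOnEigenspace_eq_one_at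
    (hPm : P.Monic) (hPe : P.natDegree = e) (hPirr : Irreducible (P.map (Int.castRingHom ℚ)))
    (hφ : Polynomial.eval₂ (Int.castRingHom (CategoryTheory.End A)) (φ : CategoryTheory.End A) P = 0)
    (her : e * (2 * m) = 2 * A.dim) (hm : m ≠ 0) (hh : h ∈ hodgeClassSpan A.dim A.X 1)
    (hnd : ∀ x : complexBetti A.X 1, (∀ y, polarizationPairingOne A.X h (A.dim - 1) x y = 0) → x = 0)
    {ρ : ℂ} (hρ : Polynomial.eval₂ (Int.castRingHom ℂ) ρ P = 0) :
    weilClassesField A φ P (2 * m) ≤ divisorClassesSpan A.X A.dim m ↔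
      ∀ u ∈ divisorLefschetzGroup A h, ∃ hc : ∀ x, u (pullbackOne A φ x) = pullbackOne A φ (u x),
        detOnEigenspace u (pullbackOne A φ) hc ρ = 1 := by
  refine ⟨fun hW u hu ↦ ?_,
    weilClassesField_le_divisorClassesSpan_of_forall_detOnEigenspace_eq_one_at hPm hPe hPirr hφ her hm hh hnd hρ⟩
  obtain ⟨hc, hdet⟩ :=
    (weilClassesField_le_divisorClassesSpan_iff_divisorLefschetzGroup_le_slF hPm hPe hPirr hφ her hh hnd).1 hW u hu
  exact ⟨hc, hdet ρ hρ⟩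

/-- **For `F ⊆ B`, at one root**: with `φ^* ∈ B ⊗ ℂ`, `W_F ⊗ ℂ ≤ 𝒟ᵐ ⊗ ℂ` iff `det(u | V_ρ) = 1` for every `u ∈ G_div(X)(ℂ)`
at ONE fixed complex root `ρ` (hypotheses as above).
[cite: MoonenZarhin1998WeilClasses, §1 proof of Criterion (2) (chunk p0003 L62–L70)] -/
theorem weilClassesField_le_divisorClassesSpan_iff_forall_detOnEigenspace_eq_one_at_of_mem_adjoin
    (hPm : P.Monic) (hPe : P.natDegree = e) (hPirr : Irreducible (P.map (Int.castRingHom ℚ)))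
    (hφ : Polynomial.eval₂ (Int.castRingHom (CategoryTheory.End A)) (φ : CategoryTheory.End A) P = 0)
    (her : e * (2 * m) = 2 * A.dim) (hm : m ≠ 0) (hh : h ∈ hodgeClassSpan A.dim A.X 1)
    (hnd : ∀ x : complexBetti A.X 1, (∀ y, polarizationPairingOne A.X h (A.dim - 1) x y = 0) → x = 0)
    (hF : pullbackOne A φ ∈ Algebra.adjoin ℂ (symmetricPullbackSpan A h : Set (Module.End ℂ (complexBetti A.X 1))))
    {ρ : ℂ} (hρ : Polynomial.eval₂ (Int.castRingHom ℂ) ρ P = 0) :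
    weilClassesField A φ P (2 * m) ≤ divisorClassesSpan A.X A.dim m ↔
      ∀ u (hu : u ∈ divisorLefschetzGroup A h), detOnEigenspace u (pullbackOne A φ)
        (comm_pullbackOne_of_mem_divisorLefschetzGroup_of_pullbackOne_mem_adjoin hF hu) ρ = 1 := by
  rw [weilClassesField_le_divisorClassesSpan_iff_forall_detOnEigenspace_eq_one_at hPm hPe hPirr hφ her hm hh hnd hρ]
  refine ⟨fun H u hu ↦ ?_, fun H u hu ↦ ⟨_, H u hu⟩⟩
  obtain ⟨hc, hdet⟩ := H u hu
  rw [VanGeemen1994.detOnEigenspace_congr rfl _ hc ρ]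
  exact hdet

/-- **The exceptional alternative, at one root**: `W_F ⊗ ℂ ⊓ 𝒟ᵐ ⊗ ℂ = ⊥` iff at the (arbitrary, fixed) root `ρ` SOME
`u ∈ G_div(X)(ℂ)` fails to lie in `Sl(V_ρ)` (does not commute with `φ^*`, or has `det(u | V_ρ) ≠ 1`). So when the Weil
classes of `F` are exceptional there is such a witness at EVERY complex embedding of `F` — the seat's g14-#3
`weilClassesField_inf_divisorClassesSpan_eq_bot_iff_exists_mem_divisorLefschetzGroup` gave one at some root
(hypotheses as above; `W_F ⊗ ℂ ≠ 0`, `exists_isRationalClass_ne_zero_mem_weilClassesField`).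
[cite: MoonenZarhin1998WeilClasses, §1 Criterion (2) («or all non-zero classes in W_F are exceptional») and its proof (chunk p0003 L46–L90)] -/
theorem weilClassesField_inf_divisorClassesSpan_eq_bot_iff_exists_mem_divisorLefschetzGroup_at
    (hPm : P.Monic) (hPe : P.natDegree = e) (hPirr : Irreducible (P.map (Int.castRingHom ℚ)))
    (hφ : Polynomial.eval₂ (Int.castRingHom (CategoryTheory.End A)) (φ : CategoryTheory.End A) P = 0)
    (her : e * (2 * m) = 2 * A.dim) (hm : m ≠ 0) (hh : h ∈ hodgeClassSpan A.dim A.X 1)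
    (hnd : ∀ x : complexBetti A.X 1, (∀ y, polarizationPairingOne A.X h (A.dim - 1) x y = 0) → x = 0)
    {ρ : ℂ} (hρ : Polynomial.eval₂ (Int.castRingHom ℂ) ρ P = 0) :
    weilClassesField A φ P (2 * m) ⊓ divisorClassesSpan A.X A.dim m = ⊥ ↔
      ∃ u ∈ divisorLefschetzGroup A h, ¬ ∃ hc : ∀ x, u (pullbackOne A φ x) = pullbackOne A φ (u x),
        detOnEigenspace u (pullbackOne A φ) hc ρ = 1 := by
  refine ⟨fun hbot ↦ ?_, fun ⟨u, hu, hnot⟩ ↦ ?_⟩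
  · by_contra hne
    push Not at hne
    have hle : weilClassesField A φ P (2 * m) ≤ divisorClassesSpan A.X A.dim m :=
      weilClassesField_le_divisorClassesSpan_of_forall_detOnEigenspace_eq_one_at hPm hPe hPirr hφ her hm hh hnd hρ hne
    obtain ⟨γ, hγW, -, hγ0⟩ := exists_isRationalClass_ne_zero_mem_weilClassesField hPm hPe hPirr hφ her
    have h0 : γ ∈ weilClassesField A φ P (2 * m) ⊓ divisorClassesSpan A.X A.dim m := ⟨hγW, hle hγW⟩
    rw [hbot, Submodule.mem_bot] at h0
    exact hγ0 h0
  · rcases weilClassesField_inf_divisorClassesSpan_eq_bot_or_le hPe hPirr hφ her hm with hbot | hle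
    · exact hbot
    · exact absurd ((weilClassesField_le_divisorClassesSpan_iff_forall_detOnEigenspace_eq_one_at hPm hPe hPirr hφ her hm
        hh hnd hρ).1 hle u hu) hnot

/-! ### §4 The divisor-form criterion: decomposability, Hodge, algebraicity -/

/-- **THE DIVISOR-FORM CRITERION — Weil classes relative to `F ⊆ B` are DECOMPOSABLE as soon as ONE divisor form is
non-degenerate on ONE eigenspace of `F`**: for `P ∈ ℤ[T]` monic irreducible of degree `e`, `P(φ) = 0`, `e · 2m = 2 dim A`,
`m ≠ 0`, `h ∈ B¹(A) ⊗ ℂ` with `Q_h` non-degenerate, `φ^* ∈ B ⊗ ℂ = Algebra.adjoin ℂ (S_λ ⊗ ℂ)` («`F ⊆ B`»), a complex root `ρ`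
of `P` and `s ∈ S_λ ⊗ ℂ` whose divisor form `φ_s(x, y) = Q_h(s x, y)` is non-degenerate on `V_ρ`: `W_F ⊗ ℂ ≤ 𝒟ᵐ ⊗ ℂ` — every
class of `W_F = ⋀^{2m}_F H¹(X, ℚ)` is a `ℂ`-combination of products of divisor classes (§2: `det(u | V_ρ) = 1` on
`G_div(X)(ℂ)`; §3: one root suffices). This replaces the print's «`G_div(X)` is connected and semi-simple, so
`G_div(X) ⊆ Sl_F(V_X)`» by a condition on ONE symmetric endomorphism; `s = 1` and `s = ψ^*` are the seat's g17-#3 / g17-#5.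
[cite: MoonenZarhin1998WeilClasses, §1 («the forms φ_s», chunk p0002 L72–L76; Criterion (2) and its proof, chunk p0003 L46–L70)]
[cite: Milne1999LefschetzClasses, Thm. 3.2, Cor. 4.5] [cite: McDuffSalamon2017, Lemma 1.1.15] -/
theorem weilClassesField_le_divisorClassesSpan_of_divisorForm
    (hPm : P.Monic) (hPe : P.natDegree = e) (hPirr : Irreducible (P.map (Int.castRingHom ℚ)))
    (hφ : Polynomial.eval₂ (Int.castRingHom (CategoryTheory.End A)) (φ : CategoryTheory.End A) P = 0)
    (her : e * (2 * m) = 2 * A.dim) (hm : m ≠ 0) (hh : h ∈ hodgeClassSpan A.dim A.X 1)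
    (hnd : ∀ x : complexBetti A.X 1, (∀ y, polarizationPairingOne A.X h (A.dim - 1) x y = 0) → x = 0)
    (hF : pullbackOne A φ ∈ Algebra.adjoin ℂ (symmetricPullbackSpan A h : Set (Module.End ℂ (complexBetti A.X 1))))
    {ρ : ℂ} (hρ : Polynomial.eval₂ (Int.castRingHom ℂ) ρ P = 0) (hs : s ∈ symmetricPullbackSpan A h)
    (hsnd : ∀ x ∈ Module.End.eigenspace (pullbackOne A φ) ρ,
      (∀ y ∈ Module.End.eigenspace (pullbackOne A φ) ρ, polarizationPairingOne A.X h (A.dim - 1) (s x) y = 0) → x = 0) :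
    weilClassesField A φ P (2 * m) ≤ divisorClassesSpan A.X A.dim m :=
  weilClassesField_le_divisorClassesSpan_of_forall_detOnEigenspace_eq_one_at hPm hPe hPirr hφ her hm hh hnd hρ fun _ hu ↦
    ⟨comm_pullbackOne_of_mem_divisorLefschetzGroup_of_pullbackOne_mem_adjoin hF hu,
      detOnEigenspace_eq_one_of_mem_divisorLefschetzGroup_of_divisorForm hs hu _ ρ hsnd⟩

/-- **… hence `det(u | V_{ρ′}) = 1` for every `u ∈ G_div(X)(ℂ)` at EVERY complex root `ρ′`** (one non-degenerate divisor
form on one `V_ρ` controls all the Weil lines: decomposability, then the seat's g14-#3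
`weilClassesField_le_divisorClassesSpan_iff_forall_detOnEigenspace_eq_one_of_mem_adjoin`, «⟹»).
[cite: MoonenZarhin1998WeilClasses, §1 Lemma (2) and proof of Criterion (2) (chunk p0003 L12–L70)] -/
theorem detOnEigenspace_eq_one_of_divisorForm_of_root
    (hPm : P.Monic) (hPe : P.natDegree = e) (hPirr : Irreducible (P.map (Int.castRingHom ℚ)))
    (hφ : Polynomial.eval₂ (Int.castRingHom (CategoryTheory.End A)) (φ : CategoryTheory.End A) P = 0)
    (her : e * (2 * m) = 2 * A.dim) (hm : m ≠ 0) (hh : h ∈ hodgeClassSpan A.dim A.X 1)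
    (hnd : ∀ x : complexBetti A.X 1, (∀ y, polarizationPairingOne A.X h (A.dim - 1) x y = 0) → x = 0)
    (hF : pullbackOne A φ ∈ Algebra.adjoin ℂ (symmetricPullbackSpan A h : Set (Module.End ℂ (complexBetti A.X 1))))
    {ρ : ℂ} (hρ : Polynomial.eval₂ (Int.castRingHom ℂ) ρ P = 0) (hs : s ∈ symmetricPullbackSpan A h)
    (hsnd : ∀ x ∈ Module.End.eigenspace (pullbackOne A φ) ρ,
      (∀ y ∈ Module.End.eigenspace (pullbackOne A φ) ρ, polarizationPairingOne A.X h (A.dim - 1) (s x) y = 0) → x = 0)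
    (hu : u ∈ divisorLefschetzGroup A h) {ρ' : ℂ} (hρ' : Polynomial.eval₂ (Int.castRingHom ℂ) ρ' P = 0) :
    detOnEigenspace u (pullbackOne A φ)
      (comm_pullbackOne_of_mem_divisorLefschetzGroup_of_pullbackOne_mem_adjoin hF hu) ρ' = 1 :=
  (weilClassesField_le_divisorClassesSpan_iff_forall_detOnEigenspace_eq_one_of_mem_adjoin hPm hPe hPirr hφ her hh hnd hF).1
    (weilClassesField_le_divisorClassesSpan_of_divisorForm hPm hPe hPirr hφ her hm hh hnd hF hρ hs hsnd) u hu ρ' hρ'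

/-- **… and are HODGE classes**: `W_F ⊗ ℂ ≤ 𝒟ᵐ ⊗ ℂ ≤ ℬᵐ ⊗ ℂ` (`divisorClassesSpan_le_hodgeClassSpan_of_isSmoothProjective`).
[cite: MoonenZarhin1998WeilClasses, §1 Criterion (2) (chunk p0003 L46–L58)] [cite: vanGeemen1994HodgeAV, §2.4] -/
theorem weilClassesField_le_hodgeClassSpan_of_divisorForm
    (hPm : P.Monic) (hPe : P.natDegree = e) (hPirr : Irreducible (P.map (Int.castRingHom ℚ)))
    (hφ : Polynomial.eval₂ (Int.castRingHom (CategoryTheory.End A)) (φ : CategoryTheory.End A) P = 0)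
    (her : e * (2 * m) = 2 * A.dim) (hm : m ≠ 0) (hh : h ∈ hodgeClassSpan A.dim A.X 1)
    (hnd : ∀ x : complexBetti A.X 1, (∀ y, polarizationPairingOne A.X h (A.dim - 1) x y = 0) → x = 0)
    (hF : pullbackOne A φ ∈ Algebra.adjoin ℂ (symmetricPullbackSpan A h : Set (Module.End ℂ (complexBetti A.X 1))))
    {ρ : ℂ} (hρ : Polynomial.eval₂ (Int.castRingHom ℂ) ρ P = 0) (hs : s ∈ symmetricPullbackSpan A h)
    (hsnd : ∀ x ∈ Module.End.eigenspace (pullbackOne A φ) ρ,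
      (∀ y ∈ Module.End.eigenspace (pullbackOne A φ) ρ, polarizationPairingOne A.X h (A.dim - 1) (s x) y = 0) → x = 0) :
    weilClassesField A φ P (2 * m) ≤ hodgeClassSpan A.dim A.X m :=
  (weilClassesField_le_divisorClassesSpan_of_divisorForm hPm hPe hPirr hφ her hm hh hnd hF hρ hs hsnd).trans
    (divisorClassesSpan_le_hodgeClassSpan_of_isSmoothProjective (AbelianVariety.isSmoothProjective_holds (A := A)) m)

/-- **… and are ALGEBRAIC**: `W_F ⊗ ℂ ≤ algebraicClasses A.X m` — «as a consequence of the Lefschetz theorem on `(1,1)`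
classes, the decomposable classes are algebraic» (the tree's theorem `lefschetzOneOne_rational_holds` through
`AbelianVariety.divisorClassesSpan_le_algebraicClasses`): THE WEIL CLASSES RELATIVE TO ANY `F ⊆ B` ADMITTING A DIVISOR
FORM NON-DEGENERATE ON ONE `V_ρ` ARE ALGEBRAIC.
[cite: MoonenZarhin1998WeilClasses, Introduction (chunk p0001 L10–L18) and §1 Criterion (2) (chunk p0003 L46–L70)]
[cite: VoisinHodgeI2002, Thm. 11.30] -/
theorem weilClassesField_le_algebraicClasses_of_divisorForm
    (hPm : P.Monic) (hPe : P.natDegree = e) (hPirr : Irreducible (P.map (Int.castRingHom ℚ)))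
    (hφ : Polynomial.eval₂ (Int.castRingHom (CategoryTheory.End A)) (φ : CategoryTheory.End A) P = 0)
    (her : e * (2 * m) = 2 * A.dim) (hm : m ≠ 0) (hh : h ∈ hodgeClassSpan A.dim A.X 1)
    (hnd : ∀ x : complexBetti A.X 1, (∀ y, polarizationPairingOne A.X h (A.dim - 1) x y = 0) → x = 0)
    (hF : pullbackOne A φ ∈ Algebra.adjoin ℂ (symmetricPullbackSpan A h : Set (Module.End ℂ (complexBetti A.X 1))))
    {ρ : ℂ} (hρ : Polynomial.eval₂ (Int.castRingHom ℂ) ρ P = 0) (hs : s ∈ symmetricPullbackSpan A h)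
    (hsnd : ∀ x ∈ Module.End.eigenspace (pullbackOne A φ) ρ,
      (∀ y ∈ Module.End.eigenspace (pullbackOne A φ) ρ, polarizationPairingOne A.X h (A.dim - 1) (s x) y = 0) → x = 0) :
    weilClassesField A φ P (2 * m) ≤ algebraicClasses A.X m :=
  (weilClassesField_le_divisorClassesSpan_of_divisorForm hPm hPe hPirr hφ her hm hh hnd hF hρ hs hsnd).trans
    (AbelianVariety.divisorClassesSpan_le_algebraicClasses A
      (fun b hb hb' ↦ lefschetzOneOne_rational_holds (AbelianVariety.isSmoothProjective_holds (A := A)) b hb hb') m)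

/-- Element form: every class of `W_F ⊗ ℂ` (in particular every rational Weil class relative to `F`) is a `ℂ`-combination
of algebraic classes. [cite: MoonenZarhin1998WeilClasses, Introduction (chunk p0001 L10–L18)] -/
theorem mem_algebraicClasses_of_mem_weilClassesField_of_divisorForm
    (hPm : P.Monic) (hPe : P.natDegree = e) (hPirr : Irreducible (P.map (Int.castRingHom ℚ)))
    (hφ : Polynomial.eval₂ (Int.castRingHom (CategoryTheory.End A)) (φ : CategoryTheory.End A) P = 0)
    (her : e * (2 * m) = 2 * A.dim) (hm : m ≠ 0) (hh : h ∈ hodgeClassSpan A.dim A.X 1)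
    (hnd : ∀ x : complexBetti A.X 1, (∀ y, polarizationPairingOne A.X h (A.dim - 1) x y = 0) → x = 0)
    (hF : pullbackOne A φ ∈ Algebra.adjoin ℂ (symmetricPullbackSpan A h : Set (Module.End ℂ (complexBetti A.X 1))))
    {ρ : ℂ} (hρ : Polynomial.eval₂ (Int.castRingHom ℂ) ρ P = 0) (hs : s ∈ symmetricPullbackSpan A h)
    (hsnd : ∀ x ∈ Module.End.eigenspace (pullbackOne A φ) ρ,
      (∀ y ∈ Module.End.eigenspace (pullbackOne A φ) ρ, polarizationPairingOne A.X h (A.dim - 1) (s x) y = 0) → x = 0)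
    {c : complexBetti A.X (2 * m)} (hc : c ∈ weilClassesField A φ P (2 * m)) : c ∈ algebraicClasses A.X m :=
  weilClassesField_le_algebraicClasses_of_divisorForm hPm hPe hPirr hφ her hm hh hnd hF hρ hs hsnd hc

/-! #### Instances: `s = 1` and `s = ψ^*` -/

/-- `𝟙^* = 1` on `H¹(A(ℂ); ℂ)` (restated; the tree's private `pullbackOne_id` of `WeilClassesFieldCentreInSubfield`). [folklore] -/
private theorem pullbackOne_id' : pullbackOne A (𝟙 A) = 1 := by
  refine LinearMap.ext fun v ↦ ?_
  change complexBetti.map (𝟙 A.X) 1 v = v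
  rw [complexBetti.map_id]
  rfl

/-- `1 ∈ S_λ ⊗ ℂ` (restated from the tree's `one_mem_symmetricPullbackSpan` of `DivisorAlgebraPowers`, to keep the import
closure small). [cite: MoonenZarhin1998WeilClasses, §1 (S_λ; chunk p0002 L54–L58)] -/
private theorem one_mem_symmetricPullbackSpan' : (1 : Module.End ℂ (complexBetti A.X 1)) ∈ symmetricPullbackSpan A h :=
  ⟨Submodule.subset_span ⟨𝟙 A, pullbackOne_id'⟩, fun _ _ ↦ rfl⟩

/-- **Instance `s = 1`: `F ⊆ B` and `Q_h|V_ρ` non-degenerate at ONE root ⟹ `W_F` decomposable** (hypotheses as in the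
criterion; the divisor form of `s = 1` is `Q_h` itself, the class of `h`). The seat's g17-#3
`weilClassesField_le_divisorClassesSpan_of_symm` is the case `F ⊆ S_λ` pointwise (there `Q_h|V^{(τ)}` is non-degenerate at
every `τ` because the eigenspaces of a symmetric `φ^*` are `Q_h`-orthogonal); here `φ^*` is only required to lie in
`B ⊗ ℂ`. [cite: MoonenZarhin1998WeilClasses, §1 Criterion (2) and its proof (chunk p0003 L46–L70); «SP(V, φ) ⊗ ℂ = ∏_τ SP(V^{(τ)}, φ^{(τ)})» (chunk p0002 L86–L92)] -/
theorem weilClassesField_le_divisorClassesSpan_of_nondegenerate_restrict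
    (hPm : P.Monic) (hPe : P.natDegree = e) (hPirr : Irreducible (P.map (Int.castRingHom ℚ)))
    (hφ : Polynomial.eval₂ (Int.castRingHom (CategoryTheory.End A)) (φ : CategoryTheory.End A) P = 0)
    (her : e * (2 * m) = 2 * A.dim) (hm : m ≠ 0) (hh : h ∈ hodgeClassSpan A.dim A.X 1)
    (hnd : ∀ x : complexBetti A.X 1, (∀ y, polarizationPairingOne A.X h (A.dim - 1) x y = 0) → x = 0)
    (hF : pullbackOne A φ ∈ Algebra.adjoin ℂ (symmetricPullbackSpan A h : Set (Module.End ℂ (complexBetti A.X 1))))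
    {ρ : ℂ} (hρ : Polynomial.eval₂ (Int.castRingHom ℂ) ρ P = 0)
    (hρnd : ∀ x ∈ Module.End.eigenspace (pullbackOne A φ) ρ,
      (∀ y ∈ Module.End.eigenspace (pullbackOne A φ) ρ, polarizationPairingOne A.X h (A.dim - 1) x y = 0) → x = 0) :
    weilClassesField A φ P (2 * m) ≤ divisorClassesSpan A.X A.dim m :=
  weilClassesField_le_divisorClassesSpan_of_divisorForm hPm hPe hPirr hφ her hm hh hnd hF hρ one_mem_symmetricPullbackSpan'
    fun x hx hx0 ↦ hρnd x hx fun y hy ↦ by simpa only [Module.End.one_apply] using hx0 y hy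

/-- **Instance `s = ψ^*`: a Rosati-SYMMETRIC endomorphism `ψ` with `Q_h(ψ^* x, y)` non-degenerate on ONE `V_ρ`, `F ⊆ B` ⟹
`W_F` decomposable** — the seat's g17-#5 `weilClassesField_le_divisorClassesSpan_of_skew` had `φ` Rosati-skew, `ψ^*`
invertible and `ψφ = -φψ` (which make `Q_h(x, ψ^* y)` non-degenerate on every `V^{(τ)}` and put `φ^*` in `B ⊗ ℂ`); here only
`φ^* ∈ B ⊗ ℂ` and the non-degeneracy at one root are asked. [cite: MoonenZarhin1998WeilClasses, §1 Criterion (2) and its proof (chunk p0003 L46–L70)] -/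
theorem weilClassesField_le_divisorClassesSpan_of_symm_pullback
    (hPm : P.Monic) (hPe : P.natDegree = e) (hPirr : Irreducible (P.map (Int.castRingHom ℚ)))
    (hφ : Polynomial.eval₂ (Int.castRingHom (CategoryTheory.End A)) (φ : CategoryTheory.End A) P = 0)
    (her : e * (2 * m) = 2 * A.dim) (hm : m ≠ 0) (hh : h ∈ hodgeClassSpan A.dim A.X 1)
    (hnd : ∀ x : complexBetti A.X 1, (∀ y, polarizationPairingOne A.X h (A.dim - 1) x y = 0) → x = 0)
    (hF : pullbackOne A φ ∈ Algebra.adjoin ℂ (symmetricPullbackSpan A h : Set (Module.End ℂ (complexBetti A.X 1))))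
    {ρ : ℂ} (hρ : Polynomial.eval₂ (Int.castRingHom ℂ) ρ P = 0)
    (hψsym : ∀ x y : complexBetti A.X 1, polarizationPairingOne A.X h (A.dim - 1) (pullbackOne A ψ x) y =
      polarizationPairingOne A.X h (A.dim - 1) x (pullbackOne A ψ y))
    (hψnd : ∀ x ∈ Module.End.eigenspace (pullbackOne A φ) ρ,
      (∀ y ∈ Module.End.eigenspace (pullbackOne A φ) ρ,
        polarizationPairingOne A.X h (A.dim - 1) (pullbackOne A ψ x) y = 0) → x = 0) :
    weilClassesField A φ P (2 * m) ≤ divisorClassesSpan A.X A.dim m :=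
  weilClassesField_le_divisorClassesSpan_of_divisorForm hPm hPe hPirr hφ her hm hh hnd hF hρ
    (pullbackOne_mem_symmetricPullbackSpan hψsym) hψnd

/-! ### §5 «The divisor classes, viewed as alternating bilinear forms on `V`»: the criterion read on a divisor CLASS -/

/-- **THE CRITERION WITH A DIVISOR CLASS**: for `dim A ≥ 1`, `h ∈ B¹(A) ⊗ ℂ` with `Q_h` non-degenerate, `B = λ ∘ Q_h` the
scalar symplectic form (`λ` an injective functional on the top line; `B` alternating), `φ^* ∈ B ⊗ ℂ`, and a DIVISOR CLASS
`c ∈ B¹(A) ⊗ ℂ` whose alternating form `ψ_c(x, y) = B(T_c x, y)` (`T_c = Milne1999.contractionOp A B c`, the print's «divisor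
classes, viewed as alternating bilinear forms on `V`» = «the forms `φ_s`, `s ∈ S_λ`», the seat's g14-#1 dictionary
`contractionOp_mem_symmetricPullbackSpan`) is non-degenerate on ONE `V_ρ`: `W_F ⊗ ℂ ≤ 𝒟ᵐ ⊗ ℂ` (other hypotheses as in §4).
[cite: MoonenZarhin1998WeilClasses, §1 (chunk p0002 L72–L76) and Criterion (2) (chunk p0003 L46–L70)]
[cite: Milne1999LefschetzClasses, §1 Prop. 1.3, §3 Prop. 3.3] [cite: LangeBirkenhake1992, Prop. 5.2.1] -/
theorem weilClassesField_le_divisorClassesSpan_of_contractionOp (hA : 1 ≤ A.dim)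
    (hPm : P.Monic) (hPe : P.natDegree = e) (hPirr : Irreducible (P.map (Int.castRingHom ℚ)))
    (hφ : Polynomial.eval₂ (Int.castRingHom (CategoryTheory.End A)) (φ : CategoryTheory.End A) P = 0)
    (her : e * (2 * m) = 2 * A.dim) (hm : m ≠ 0) (hh : h ∈ hodgeClassSpan A.dim A.X 1)
    (hnd : ∀ x : complexBetti A.X 1, (∀ y, polarizationPairingOne A.X h (A.dim - 1) x y = 0) → x = 0)
    (hF : pullbackOne A φ ∈ Algebra.adjoin ℂ (symmetricPullbackSpan A h : Set (Module.End ℂ (complexBetti A.X 1))))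
    {ρ : ℂ} (hρ : Polynomial.eval₂ (Int.castRingHom ℂ) ρ P = 0)
    {B : LinearMap.BilinForm ℂ (complexBetti A.X 1)} {lam : complexBetti A.X (2 + 2 * (A.dim - 1)) →ₗ[ℂ] ℂ}
    (hBalt : B.IsAlt) (hlam : Function.Injective lam)
    (hB : ∀ a c, B a c = lam (polarizationPairingOne A.X h (A.dim - 1) a c))
    {c : complexBetti A.X 2} (hc : c ∈ hodgeClassSpan A.dim A.X 1)
    (hcnd : ∀ x ∈ Module.End.eigenspace (pullbackOne A φ) ρ,
      (∀ y ∈ Module.End.eigenspace (pullbackOne A φ) ρ, B (contractionOp A B c x) y = 0) → x = 0) :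
    weilClassesField A φ P (2 * m) ≤ divisorClassesSpan A.X A.dim m :=
  weilClassesField_le_divisorClassesSpan_of_divisorForm hPm hPe hPirr hφ her hm hh hnd hF hρ
    (contractionOp_mem_symmetricPullbackSpan hA hh hBalt hlam hB hc) fun x hx hx0 ↦
      hcnd x hx fun y hy ↦ by rw [hB, hx0 y hy, map_zero]

/-! ### §6 (rider) The PROJECTION CRITERION: a Rosati-symmetric IDEMPOTENT mapping `V_ρ` isomorphically onto its image -/

/-- **The divisor form of a symmetric idempotent `s` is non-degenerate on `V_ρ` as soon as `s` maps `V_ρ` ISOMORPHICALLY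
onto `s(H¹)`** (`Q_h` non-degenerate): `φ_s(v, v′) = Q_h(s v, v′) = Q_h(s v, s v′)` (`s† = s = s²`), and `Q_h(s v, ·)`
vanishes on `ker s` — so if `φ_s(v, ·)|V_ρ = 0` with `s(V_ρ) = s(H¹)` then `Q_h(s v, ·) = 0`, `s v = 0`, `v = 0`. The
situation of a power `X = A^n` with `F ⊆ M_n(ℚ)` acting through the regular representation (`A ⊗ F`, Deligne's
`A₀ ⊗ E` for a CM field `E`): `s = e₁₁` the projector onto the first factor, `V_ρ ≅ H¹(A)` the graph of the
`ρ`-eigenvector of the matrix. [cite: MoonenZarhin1998WeilClasses, §1 («the forms φ_s», chunk p0002 L72–L76)]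
[cite: Deligne1982HodgeCycles, §4 (4.4)–(4.5) (A₀ ⊗ E)] -/
theorem forall_polarizationPairingOne_apply_eq_zero_imp_of_symm_idempotent
    (hnd : ∀ x : complexBetti A.X 1, (∀ y, polarizationPairingOne A.X h (A.dim - 1) x y = 0) → x = 0)
    (hsym : ∀ x y : complexBetti A.X 1, polarizationPairingOne A.X h (A.dim - 1) (s x) y =
      polarizationPairingOne A.X h (A.dim - 1) x (s y))
    (hid : s * s = s) {ρ : ℂ} (hinj : ∀ x ∈ Module.End.eigenspace (pullbackOne A φ) ρ, s x = 0 → x = 0)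
    (hsurj : ∀ w : complexBetti A.X 1, ∃ v ∈ Module.End.eigenspace (pullbackOne A φ) ρ, s v = s w) :
    ∀ x ∈ Module.End.eigenspace (pullbackOne A φ) ρ,
      (∀ y ∈ Module.End.eigenspace (pullbackOne A φ) ρ, polarizationPairingOne A.X h (A.dim - 1) (s x) y = 0) → x = 0 := by
  intro x hx h0
  refine hinj x hx (hnd (s x) fun w ↦ ?_)
  obtain ⟨v, hv, hsv⟩ := hsurj w
  have hss : ∀ z, s (s z) = s z := fun z ↦ by rw [← Module.End.mul_apply, hid]
  calc polarizationPairingOne A.X h (A.dim - 1) (s x) w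
      = polarizationPairingOne A.X h (A.dim - 1) (s (s x)) w := by rw [hss]
    _ = polarizationPairingOne A.X h (A.dim - 1) (s x) (s v) := by rw [hsym, hsv]
    _ = polarizationPairingOne A.X h (A.dim - 1) (s (s x)) v := (hsym (s x) v).symm
    _ = 0 := by rw [hss, h0 v hv]

/-- **THE PROJECTION CRITERION**: `φ^* ∈ B ⊗ ℂ`, and a `Q_h`-symmetric idempotent `s ∈ S_λ ⊗ ℂ` (e.g. the pull-back of a
Rosati-symmetric idempotent endomorphism — a «factor» of `X`) which maps ONE eigenspace `V_ρ` injectively onto `s(H¹)`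
⟹ `W_F ⊗ ℂ ≤ 𝒟ᵐ ⊗ ℂ` (§4 with the previous lemma; `P` monic irreducible of degree `e`, `P(φ) = 0`, `e · 2m = 2 dim A`,
`m ≠ 0`, `h ∈ B¹(A) ⊗ ℂ` with `Q_h` non-degenerate). The intended carrier instances are the `F`-SPLIT abelian varieties
`X = A ⊗ F` (`A^n` with `F ⊆ M_n(ℚ)`, `n = [F:ℚ]`, any `A`, any number field `F`), where `s` is the projector onto a
factor. [cite: MoonenZarhin1998WeilClasses, §1 Criterion (2) and its proof (chunk p0003 L46–L70); «the forms φ_s» (chunk p0002 L72–L76)]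
[cite: Deligne1982HodgeCycles, §4 (4.4)–(4.5)] -/
theorem weilClassesField_le_divisorClassesSpan_of_symm_idempotent
    (hPm : P.Monic) (hPe : P.natDegree = e) (hPirr : Irreducible (P.map (Int.castRingHom ℚ)))
    (hφ : Polynomial.eval₂ (Int.castRingHom (CategoryTheory.End A)) (φ : CategoryTheory.End A) P = 0)
    (her : e * (2 * m) = 2 * A.dim) (hm : m ≠ 0) (hh : h ∈ hodgeClassSpan A.dim A.X 1)
    (hnd : ∀ x : complexBetti A.X 1, (∀ y, polarizationPairingOne A.X h (A.dim - 1) x y = 0) → x = 0)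
    (hF : pullbackOne A φ ∈ Algebra.adjoin ℂ (symmetricPullbackSpan A h : Set (Module.End ℂ (complexBetti A.X 1))))
    {ρ : ℂ} (hρ : Polynomial.eval₂ (Int.castRingHom ℂ) ρ P = 0) (hs : s ∈ symmetricPullbackSpan A h)
    (hid : s * s = s) (hinj : ∀ x ∈ Module.End.eigenspace (pullbackOne A φ) ρ, s x = 0 → x = 0)
    (hsurj : ∀ w : complexBetti A.X 1, ∃ v ∈ Module.End.eigenspace (pullbackOne A φ) ρ, s v = s w) :
    weilClassesField A φ P (2 * m) ≤ divisorClassesSpan A.X A.dim m :=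
  weilClassesField_le_divisorClassesSpan_of_divisorForm hPm hPe hPirr hφ her hm hh hnd hF hρ hs
    (forall_polarizationPairingOne_apply_eq_zero_imp_of_symm_idempotent hnd hs.2 hid hinj hsurj)

/-- **… and the Weil classes are then ALGEBRAIC.** [cite: MoonenZarhin1998WeilClasses, Introduction (chunk p0001 L10–L18) and §1 Criterion (2) (chunk p0003 L46–L70)]
[cite: VoisinHodgeI2002, Thm. 11.30] -/
theorem weilClassesField_le_algebraicClasses_of_symm_idempotent
    (hPm : P.Monic) (hPe : P.natDegree = e) (hPirr : Irreducible (P.map (Int.castRingHom ℚ)))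
    (hφ : Polynomial.eval₂ (Int.castRingHom (CategoryTheory.End A)) (φ : CategoryTheory.End A) P = 0)
    (her : e * (2 * m) = 2 * A.dim) (hm : m ≠ 0) (hh : h ∈ hodgeClassSpan A.dim A.X 1)
    (hnd : ∀ x : complexBetti A.X 1, (∀ y, polarizationPairingOne A.X h (A.dim - 1) x y = 0) → x = 0)
    (hF : pullbackOne A φ ∈ Algebra.adjoin ℂ (symmetricPullbackSpan A h : Set (Module.End ℂ (complexBetti A.X 1))))
    {ρ : ℂ} (hρ : Polynomial.eval₂ (Int.castRingHom ℂ) ρ P = 0) (hs : s ∈ symmetricPullbackSpan A h)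
    (hid : s * s = s) (hinj : ∀ x ∈ Module.End.eigenspace (pullbackOne A φ) ρ, s x = 0 → x = 0)
    (hsurj : ∀ w : complexBetti A.X 1, ∃ v ∈ Module.End.eigenspace (pullbackOne A φ) ρ, s v = s w) :
    weilClassesField A φ P (2 * m) ≤ algebraicClasses A.X m :=
  weilClassesField_le_algebraicClasses_of_divisorForm hPm hPe hPirr hφ her hm hh hnd hF hρ hs
    (forall_polarizationPairingOne_apply_eq_zero_imp_of_symm_idempotent hnd hs.2 hid hinj hsurj)

/-- **The pull-back of a Rosati-symmetric idempotent endomorphism `ε` (`ε ≫ ε = ε`, `ε† = ε`) is a symmetric idempotent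
of `S_λ ⊗ ℂ`** — the shape in which the projection criterion is fed by a «factor» of `X`.
[cite: MoonenZarhin1998WeilClasses, §1 (S_λ; chunk p0002 L54–L58)] [cite: LangeBirkenhake1992, §5.1] -/
theorem pullbackOne_mul_self_of_comp_eq {ε : A ⟶ A} (hε : ε ≫ ε = ε) :
    pullbackOne A ε * pullbackOne A ε = pullbackOne A ε := by
  change _ = (complexBetti.map (ε.hom.hom.hom) 1).hom
  conv_rhs => rw [← hε]
  change _ = (complexBetti.map (ε.hom.hom.hom ≫ ε.hom.hom.hom) 1).hom
  rw [complexBetti.map_comp, ModuleCat.hom_comp]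
  rfl

end HodgeTheory

end Literature.AlgebraicGeometry.HodgeTheory

end
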